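import Literature.NumberTheory.EllipticCurves.BurungaleKobayashiNakamuraOta2026.RubinPadicLFunction
import Summits.BirchSwinnertonDyer.BirchSwinnertonDyer.Theorems.RamifiedSevenEllipticUnitsRelativeValuationAnatomy
import HarnessLib

set_option linter.dupNamespace false
set_option autoImplicit false

/-!
# K7r crux `EllipticUnitValueSevenOfGZK` (stmt-BirchSwinnertonDyer-19945), line `rubin-formula-zp`, stub
# S_relval — THE SIGN INPUT OF Thm. 4.12 FROM NON-VANISHING: in weight `2k+2`, a functional equation with
# ANY root number `W` and a non-zero central value force `W = +1`; hence the carrier clause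
# `(L/L₀)² = r ≠ 0` of S_relval supplies BOTH sign hypotheses of the datum theorem
# (`…RelativeValuationOfDatum`, p493974) once a functional equation with some `W` is known (Hecke)
# (cell `bsd-cm`, seat `bsd-cm-k7r-c3` g9; helper, `--supports` 19945; the weight-`2k+2` twin of
# k7r-c2's `…ConjugateTwistSign` §1)

HONEST FRAMING. Elementary complex analysis on the tree's predicates `IsCentralRootNumberWt`
(`RubinPadicLFunction.lean`: `∃ B > 0, ∃ Λ entire, Λ = Γ·B^s·L(ψ,·)` on `re s > k + 3/2`,
`Λ(s) = W Λ(2k+2−s)`) and `heckeCentralValue ψ k = LFunction.entireContinuationFrom (k+3/2) (heckeLFunction ψ)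
(k+1)`; no functional equation is asserted; nothing about the crux; BSD is not proved by any of this.
* `exists_continuation_central_zero_of_isCentralRootNumberWt_ne_one`: `W ≠ 1 ⇒` an entire continuation
  of `L(ψ, s)` from `re s > k + 3/2` vanishing at `s = k+1` (namely `Λ·Γ⁻¹·B^{−s}`).
* `heckeCentralValue_eq_zero_of_isCentralRootNumberWt_ne_one` (uniqueness of continuations,
  `LFunction.entireContinuationFrom_eq_of_mem`), `rootNumber_eq_one_of_heckeCentralValue_ne_zero`,
  `isCentralRootNumberWt_one_of_heckeCentralValue_ne_zero`.
* `isCentralRootNumberWt_one_of_div_sq_eq`: `(L/L₀)² = r ≠ 0` (`L = heckeCentralValue ψ k`,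
  `L₀ = heckeCentralValue ψ₀ k`) and functional equations with SOME signs `W`, `W₀` ⇒ both signs are `+1`
  — so in the v4 split of S_relval the input [sgn] reads «a functional equation exists» (Hecke 1920), not
  «its sign is `+1`» ([BKNO] Lemma 4.4 (1) / parity, untyped).
References: E. Hecke, Math. Z. 6 (1920) (functional equation of `L(s, χ)` for Grössencharaktere)
[Hecke1920]; J. Neukirch, *Algebraic Number Theory* (1999) VII §8 (8.5)–(8.6) [NeukirchANT1999];
[BKNO] arXiv:2608.06879 §4.1.2, Lemma 4.4 (1) [BurungaleKobayashiNakamuraOta2026]; cell STATUS D131.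
-/

noncomputable section

open scoped Classical

namespace Summit.BirchSwinnertonDyer.BirchSwinnertonDyer.Theorems.RamifiedSevenEllipticUnits

open NumberField Literature.NumberTheory.EllipticCurves
  Literature.NumberTheory.EllipticCurves.BurungaleKobayashiNakamuraOta2026
  Literature.NumberTheory.GaloisRepresentations Literature.NumberTheory.DiophantineGeometry

namespace CentralSign

variable {K : Type} [Field K] [NumberField K] {ψ ψ₀ : HeckeCharacter K} {k : ℕ} {W W₀ : ℂ}

/-- **A root number `W ≠ 1` in weight `2k+2` forces a central zero**: from `Λ(s) = W·Λ(2k+2−s)` at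
`s = k+1`, `(1 − W)Λ(k+1) = 0`, so `Λ(k+1) = 0`; and `F(s) := Λ(s)·Γ(s)⁻¹·B^{−s}` is an entire
continuation of `L(ψ, s)` from `re s > k + 3/2` with `F(k+1) = 0`.
[cite: NeukirchANT1999, Ch. VII §8 (8.5)–(8.6) (the completed Hecke L-function; shape only)] -/
theorem exists_continuation_central_zero_of_isCentralRootNumberWt_ne_one
    (h : IsCentralRootNumberWt ψ k W) (hW : W ≠ 1) :
    ∃ F : ℂ → ℂ, F ∈ LFunction.entireContinuationsFrom ((k : ℝ) + 3 / 2) (heckeLFunction ψ) ∧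
      F ((k : ℂ) + 1) = 0 := by
  obtain ⟨B, hB, Λ, hΛd, hΛL, hΛfe⟩ := h
  have hBC : (B : ℂ) ≠ 0 := by exact_mod_cast hB.ne'
  -- `Λ(k+1) = W Λ(k+1)` with `W ≠ 1` forces `Λ(k+1) = 0`
  have hΛ1 : Λ ((k : ℂ) + 1) = 0 := by
    have h1 := hΛfe ((k : ℂ) + 1)
    rw [show 2 * (k : ℂ) + 2 - ((k : ℂ) + 1) = (k : ℂ) + 1 by ring] at h1
    have h2 : (1 - W) * Λ ((k : ℂ) + 1) = 0 := by linear_combination h1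
    exact (mul_eq_zero.1 h2).resolve_left (sub_ne_zero.2 (Ne.symm hW))
  refine ⟨fun s ↦ Λ s * (Complex.Gamma s)⁻¹ * (B : ℂ) ^ (-s), ?_, ?_⟩
  · rw [LFunction.mem_entireContinuationsFrom]
    refine ⟨fun s ↦ ?_, fun s hs ↦ ?_⟩
    · -- entire: `Λ`, `1/Γ` and `B^{−s}` are entire
      have hcpow : DifferentiableAt ℂ (fun s : ℂ ↦ (B : ℂ) ^ (-s)) s :=
        differentiableAt_id.neg.const_cpow (Or.inl hBC)
      exact ((hΛd s).mul (Complex.differentiable_one_div_Gamma s)).mul hcpow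
    · -- agrees with `L(ψ, s)` on `re s > k + 3/2`
      have hre : 0 < s.re := by
        have : (0 : ℝ) ≤ (k : ℝ) := Nat.cast_nonneg k
        linarith
      have hΓ : Complex.Gamma s ≠ 0 := Complex.Gamma_ne_zero_of_re_pos hre
      have hBs : (B : ℂ) ^ s ≠ 0 := by
        intro h0
        exact hBC ((Complex.cpow_eq_zero_iff _ _).1 h0).1
      rw [hΛL s hs, Complex.cpow_neg]
      field_simp
  · show Λ ((k : ℂ) + 1) * (Complex.Gamma ((k : ℂ) + 1))⁻¹ * (B : ℂ) ^ (-((k : ℂ) + 1)) = 0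
    rw [hΛ1, zero_mul, zero_mul]

/-- Hence the tree's central value `heckeCentralValue ψ k` (the value at `k+1` of THE entire continuation
from `re s > k + 3/2`, unique when it exists) VANISHES when the root number is not `+1`.
[cite: NeukirchANT1999, Ch. VII §8 (8.5)–(8.6) (shape only)] -/
theorem heckeCentralValue_eq_zero_of_isCentralRootNumberWt_ne_one
    (h : IsCentralRootNumberWt ψ k W) (hW : W ≠ 1) : heckeCentralValue ψ k = 0 := by
  obtain ⟨F, hF, hF0⟩ := exists_continuation_central_zero_of_isCentralRootNumberWt_ne_one h hW
  rw [heckeCentralValue, LFunction.entireContinuationFrom_eq_of_mem hF, hF0]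

/-- **Non-vanishing forces the sign `+1`**: `IsCentralRootNumberWt ψ k W` and `heckeCentralValue ψ k ≠ 0`
give `W = 1`. [cite: NeukirchANT1999, Ch. VII §8 (8.5)–(8.6) (shape only)] -/
theorem rootNumber_eq_one_of_heckeCentralValue_ne_zero (h : IsCentralRootNumberWt ψ k W)
    (hne : heckeCentralValue ψ k ≠ 0) : W = 1 := by
  by_contra hW
  exact hne (heckeCentralValue_eq_zero_of_isCentralRootNumberWt_ne_one h hW)

/-- … so the functional equation holds with sign `+1` — the hypothesis `hsgn` of the datum theorem
`RelativeValuationOfDatum.norm_constantCoeff_sq_eq_of_data` and of `RubinPadicLFunctionData.thm412`.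
[cite: BurungaleKobayashiNakamuraOta2026, Thm. 4.12 (arXiv:2608.06879 p. 32) (its sign hypothesis; shape only)] -/
theorem isCentralRootNumberWt_one_of_heckeCentralValue_ne_zero (h : IsCentralRootNumberWt ψ k W)
    (hne : heckeCentralValue ψ k ≠ 0) : IsCentralRootNumberWt ψ k 1 := by
  obtain rfl := rootNumber_eq_one_of_heckeCentralValue_ne_zero h hne
  exact h

/-- **BOTH SIGN INPUTS OF THE DATUM THEOREM FROM ITS CARRIER CLAUSE**: if `L(ψ, ·)` and `L(ψ₀, ·)` have
functional equations in weight `2k+2` with SOME root numbers `W`, `W₀` (Hecke), and the carrier clause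
`(heckeCentralValue ψ k / heckeCentralValue ψ₀ k)² = r` holds with `r ≠ 0`, then both root numbers are
`+1`: `IsCentralRootNumberWt ψ k 1 ∧ IsCentralRootNumberWt ψ₀ k 1`. So in the v4 split of S_relval the
sign residual is «a functional equation exists», not «its sign is `+1`».
[cite: BurungaleKobayashiNakamuraOta2026, Thm. 4.12 and §4.1.2 (arXiv:2608.06879 pp. 25, 32) (the sign hypothesis; shape only)] -/
theorem isCentralRootNumberWt_one_of_div_sq_eq (hW : IsCentralRootNumberWt ψ k W)
    (hW₀ : IsCentralRootNumberWt ψ₀ k W₀) {r : ℚ}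
    (hρ : (heckeCentralValue ψ k / heckeCentralValue ψ₀ k) ^ 2 = (r : ℂ)) (hr : r ≠ 0) :
    IsCentralRootNumberWt ψ k 1 ∧ IsCentralRootNumberWt ψ₀ k 1 :=
  have hne := RelativeValuationAnatomy.ne_zero_and_ne_zero_of_div_sq_eq hρ hr
  ⟨isCentralRootNumberWt_one_of_heckeCentralValue_ne_zero hW hne.1,
    isCentralRootNumberWt_one_of_heckeCentralValue_ne_zero hW₀ hne.2⟩

end CentralSign

end Summit.BirchSwinnertonDyer.BirchSwinnertonDyer.Theorems.RamifiedSevenEllipticUnits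

end
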